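import Literature.NumberTheory.NumberFields.DyadicNonNormAtPrimeIdeal
import Literature.NumberTheory.NumberFields.QuadraticExtensionOddClassNumberNonNormUnit
import Literature.NumberTheory.NumberFields.AmbiguousClassNumberInequality
import HarnessLib

/-!
# Non-norm units of a quadratic extension `L = K(√m)` from a dyadic residue at a prime IDEAL of `𝓞 K`, in the currency of
# Chevalley's formula (`E_K ∋ u ∉ N_G(Lˣ)`): `u ≡ ±3 (mod 𝔭³)` for `m = 2` (`e = f = 1`); `u ≡ 1 (mod 𝔭⁴)`, `≢ 1 (mod 𝔭⁵)` for `𝔭 ‖ m` (`e = 2`, `f = 1`)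

Topic `NumberTheory/NumberFields`; namespace `Literature.NumberTheory.NumberFields.AmbiguousClass`.  THEOREM-ONLY file (no
definition, no named fact, no instance, no `sorry`).  Glue between `DyadicNonNormAtPrimeIdeal.lean` (the residue ⟹ «`u ≠ x² − m y²` in
`K`», at a prime ideal, principal or not) and `QuadraticExtensionOddClassNumberNonNormUnit.not_mem_map_norm_of_forall_sq_sub_mul_sq_ne`
(«`u ≠ x² − m y²`» ⟹ `u ∉ N_G(Lˣ)`), delivering EXACTLY the unit hypotheses `hxE`, `hxN` of the `p = 2` unit-norm-index doors
(`IwasawaTheory/ClassicalMuVanishesUnitNormIndexTwoNonNormUnits.lean`):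

* `unitsIncl_unitsMap_mem_unitsE_inf_range` — a unit `v` of `𝓞 K` gives an element of `E_K = 𝓞_Lˣ ∩ Kˣ ≤ Lˣ`
  (`range_unitsIncl_comp_unitsMap_eq`); `unitsIncl_unitsMap_mul` — multiplicativity (for the «`xy ∉ N`» clause).
* `unitsIncl_unitsMap_not_mem_map_norm_of_sub_three_mem_pow_three` / `…_of_add_three_mem_pow_three` — `L = K(s)`, `s² = 2`, `s ∉ K`;
  `𝔭` a prime of `𝓞 K` with `#(𝓞 K/𝔭) = 2`… in the form `∀ r, r ∈ 𝔭 ∨ r − 1 ∈ 𝔭`, `2 ∈ 𝔭 ∖ 𝔭²`; `v ∓ 3 ∈ 𝔭³` ⟹ `v ∉ N_G(Lˣ)`.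
* `unitsIncl_unitsMap_not_mem_map_norm_of_sub_one_mem_pow_four` — `L = K(s)`, `s² = m ∈ 𝓞 K`, `s ∉ K`; `𝔭` with residue field `𝔽₂`,
  `2 ∈ 𝔭² ∖ 𝔭³`, `m ∈ 𝔭 ∖ 𝔭²`; `v − 1 ∈ 𝔭⁴ ∖ 𝔭⁵` ⟹ `v ∉ N_G(Lˣ)`.  (For the cyclotomic layer `F₁(√(2+√2))/F₁`, `F₁ = F(√2)`,
  `2` unramified in `F`: `m = 2 + √2` at any dyadic prime of `F₁`.)

HONEST SCOPE: packaging only; nothing specific to any summit; BSD is not advanced by this file.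

## References

* O. T. O'Meara, *Introduction to Quadratic Forms* (1963), §63A–B (63:1, 63:10). [Omeara1963]
* S. Lang, *Cyclotomic Fields I and II*, GTM 121 (1990), Ch. 13 §4, Lemma 4.1 (the index `(E_F : N K^* ∩ E_F)`). [Lang1990]
-/

noncomputable section

open NumberField

namespace Literature.NumberTheory.NumberFields.AmbiguousClass

open Literature.NumberTheory.GaloisRepresentations Literature.NumberTheory.GaloisRepresentations.Herbrand
  Literature.NumberTheory.GaloisRepresentations.MinkowskiUnit
  Literature.NumberTheory.GaloisRepresentations.CyclicNormIndex

variable {K L : Type} [Field K] [NumberField K] [Field L] [NumberField L] [Algebra K L]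

omit [NumberField K] [NumberField L] in
/-- A unit `v` of `𝓞 K`, viewed in `Lˣ`, lies in `E_K = 𝓞_Lˣ ∩ Kˣ` (tree `range_unitsIncl_comp_unitsMap_eq`: `j(E_K) = 𝓞_Lˣ ∩ Kˣ`);
the Literature-side twin of the BSD tree's `AlignedTransportAtTwoCubicLayerOneParity.unitsIncl_map_mem` (Summits files are not
importable here). [cite: Lang1990, Ch. 13 §4 (E_F = the units of F, viewed in K)] -/
theorem unitsIncl_unitsMap_mem_unitsE_inf_range (v : (𝓞 K)ˣ) :
    unitsIncl K L (Units.map (algebraMap (𝓞 K) K : 𝓞 K →* K) v) ∈ unitsE L ⊓ (unitsIncl K L).range := by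
  rw [← range_unitsIncl_comp_unitsMap_eq]
  exact ⟨v, rfl⟩

omit [NumberField K] [NumberField L] in
/-- Multiplicativity of `v ↦ j(v) ∈ Lˣ` on the units of `𝓞 K` (so the «`x·y ∉ N`» clause of the two-unit doors is a statement about the
product unit `v₁ v₂`). [cite: Lang1990, Ch. 13 §4 (E_F viewed in K)] -/
theorem unitsIncl_unitsMap_mul (v₁ v₂ : (𝓞 K)ˣ) :
    unitsIncl K L (Units.map (algebraMap (𝓞 K) K : 𝓞 K →* K) v₁) *
        unitsIncl K L (Units.map (algebraMap (𝓞 K) K : 𝓞 K →* K) v₂) =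
      unitsIncl K L (Units.map (algebraMap (𝓞 K) K : 𝓞 K →* K) (v₁ * v₂)) := by
  rw [map_mul, map_mul]

/-- **`v ≡ 3 (mod 𝔭³)` is not a norm from `L = K(√2)`** (`[L:K] = 2`, `s² = 2`, `s ∉ K`), at a dyadic prime ideal `𝔭` of `𝓞 K` with
`e = f = 1` (`∀ r, r ∈ 𝔭 ∨ r − 1 ∈ 𝔭`; `2 ∈ 𝔭 ∖ 𝔭²`), principal or not: `j(v) ∉ N_G(Lˣ)` — the non-norm unit of Chevalley's formula
(`(v, 2)_𝔭 = −1`). [cite: Omeara1963, §63B (63:10)] [cite: Lang1990, Ch. 13 §4, Lemma 4.1 (PDF p. 203)] -/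
theorem unitsIncl_unitsMap_not_mem_map_norm_of_sub_three_mem_pow_three [IsGalois K L] (hdeg : Module.finrank K L = 2)
    {s : L} (hs : s ^ 2 = 2) (hsK : s ∉ Set.range (algebraMap K L)) (P : Ideal (𝓞 K)) [P.IsMaximal] (hP0 : P ≠ ⊥)
    (hres : ∀ r : 𝓞 K, r ∈ P ∨ r - 1 ∈ P) (h2 : (2 : 𝓞 K) ∈ P) (h2' : (2 : 𝓞 K) ∉ P ^ 2) (v : (𝓞 K)ˣ)
    (h3 : (v : 𝓞 K) - 3 ∈ P ^ 3) :
    unitsIncl K L (Units.map (algebraMap (𝓞 K) K : 𝓞 K →* K) v) ∉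
      (⊤ : Subgroup Lˣ).map (Herbrand.norm (L ≃ₐ[K] L)) := by
  haveI : FiniteDimensional K L := Module.Finite.of_restrictScalars_finite ℚ K L
  refine not_mem_map_norm_of_forall_sq_sub_mul_sq_ne hdeg (m := 2) (by rw [hs, map_ofNat]) hsK _ fun a b => ?_
  have h := forall_sq_sub_two_mul_sq_ne_of_sub_three_mem_pow_three P K hP0 hres h2 h2' h3 a b
  simpa using h

/-- **`v ≡ −3 (mod 𝔭³)` is not a norm from `L = K(√2)`** at a dyadic prime ideal with `e = f = 1` (`(v, 2)_𝔭 = −1` for `v ≡ 5 (mod 8)`).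
[cite: Omeara1963, §63B (63:10)] [cite: Lang1990, Ch. 13 §4, Lemma 4.1 (PDF p. 203)] -/
theorem unitsIncl_unitsMap_not_mem_map_norm_of_add_three_mem_pow_three [IsGalois K L] (hdeg : Module.finrank K L = 2)
    {s : L} (hs : s ^ 2 = 2) (hsK : s ∉ Set.range (algebraMap K L)) (P : Ideal (𝓞 K)) [P.IsMaximal] (hP0 : P ≠ ⊥)
    (hres : ∀ r : 𝓞 K, r ∈ P ∨ r - 1 ∈ P) (h2 : (2 : 𝓞 K) ∈ P) (h2' : (2 : 𝓞 K) ∉ P ^ 2) (v : (𝓞 K)ˣ)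
    (h3 : (v : 𝓞 K) + 3 ∈ P ^ 3) :
    unitsIncl K L (Units.map (algebraMap (𝓞 K) K : 𝓞 K →* K) v) ∉
      (⊤ : Subgroup Lˣ).map (Herbrand.norm (L ≃ₐ[K] L)) := by
  haveI : FiniteDimensional K L := Module.Finite.of_restrictScalars_finite ℚ K L
  refine not_mem_map_norm_of_forall_sq_sub_mul_sq_ne hdeg (m := 2) (by rw [hs, map_ofNat]) hsK _ fun a b => ?_
  have h := forall_sq_sub_two_mul_sq_ne_of_add_three_mem_pow_three P K hP0 hres h2 h2' h3 a b
  simpa using h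

/-- **`v ≡ 1 (mod 𝔭⁴)`, `v ≢ 1 (mod 𝔭⁵)` is not a norm from `L = K(√m)` for `𝔭 ‖ m`** (`[L:K] = 2`, `s² = m ∈ 𝓞 K`, `s ∉ K`), at a
dyadic prime ideal `𝔭` of `𝓞 K` with `e = 2`, `f = 1` (`∀ r, r ∈ 𝔭 ∨ r − 1 ∈ 𝔭`; `2 ∈ 𝔭² ∖ 𝔭³`; `m ∈ 𝔭 ∖ 𝔭²`), principal or not:
`j(v) ∉ N_G(Lˣ)` (`(v, m)_𝔭 = −1`).  For the layer `K₂ = K₁(√(2+√2))` over `K₁ = F(√2)` of the cyclotomic `ℤ₂`-tower of a field `F`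
in which `2` is unramified: `m = 2 + √2` at any dyadic `𝔭` of `K₁`. [cite: Omeara1963, §63A (63:1) and §63B (63:10)]
[cite: Lang1990, Ch. 13 §4, Lemma 4.1 (PDF p. 203)] -/
theorem unitsIncl_unitsMap_not_mem_map_norm_of_sub_one_mem_pow_four [IsGalois K L] (hdeg : Module.finrank K L = 2)
    {m : 𝓞 K} {s : L} (hs : s ^ 2 = algebraMap K L (m : K)) (hsK : s ∉ Set.range (algebraMap K L))
    (P : Ideal (𝓞 K)) [P.IsMaximal] (hP0 : P ≠ ⊥) (hres : ∀ r : 𝓞 K, r ∈ P ∨ r - 1 ∈ P)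
    (h2 : (2 : 𝓞 K) ∈ P ^ 2) (h2' : (2 : 𝓞 K) ∉ P ^ 3) (hm : m ∈ P) (hm' : m ∉ P ^ 2) (v : (𝓞 K)ˣ)
    (h4 : (v : 𝓞 K) - 1 ∈ P ^ 4) (h5 : (v : 𝓞 K) - 1 ∉ P ^ 5) :
    unitsIncl K L (Units.map (algebraMap (𝓞 K) K : 𝓞 K →* K) v) ∉
      (⊤ : Subgroup Lˣ).map (Herbrand.norm (L ≃ₐ[K] L)) := by
  haveI : FiniteDimensional K L := Module.Finite.of_restrictScalars_finite ℚ K L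
  refine not_mem_map_norm_of_forall_sq_sub_mul_sq_ne hdeg hs hsK _ fun a b => ?_
  have h := forall_sq_sub_mul_sq_ne_of_sub_one_mem_pow_four P K hP0 hres h2 h2' hm hm' h4 h5 a b
  simpa using h

end Literature.NumberTheory.NumberFields.AmbiguousClass

end
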